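import Summits.Ventures.YMGap.RobustBall.Defs
import Summits.Ventures.YMGap.RobustBall.Targets
import Summits.Ventures.YMGap.Thresholds.PlaquetteActionWindow
import HarnessLib

/-!
# Venture YMGap — ROBUST-BALL (Y2), `RobustBall/PlaquetteActionBridge`: the PLAQUETTE RUNG of the ball in the cell's
# currencies — bridge `perturbedTorusSpec W β = torusWeightSpec (v_β e^{−f})` and torus clustering `ClustersWith W β A m`

HONEST FRAMING: venture file (cell `pub-ymgap`, seat ds-4), strong-coupling LATTICE bookkeeping on the torus
`(ℤ/L)^d`; nothing about the continuum or a Clay-sense mass gap.  Rows through this file are the «plaquette rung»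
(sub-ball `IsPlaquetteAction`, rb-ref T0.6) — members with polymers larger than a plaquette are NOT covered (crux
Y2-X2, off-column entries, stays open).

CONTENT.  For a member `W` of rb-theory's carrier with `IsPlaquetteAction f W` (`W.total U = Σ_q f(U_q)`, ONE density):
* `perturbedTorusSpec_eq_torusWeightSpec` — the specification bridge (the body of rb-theory's `PlaquetteBridgeTarget`,
  HOME/rb/lean/RobustBallDefs.lean v0.2; `RobustBall/Targets.lean` discharges it by this lemma in one line):
  `perturbedTorusSpec W β = torusWeightSpec (fun g => v_β g · e^{−f g})`;
* `perturbedMeasure_eq_groupHeatKernelMeasure` — the measure bridge: the member's torus measure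
  `W.perturbedMeasure (fundamentalRep (Fin N)) β` IS the plaquette-weight measure of `v_β e^{−f}`;
* `clustersWith_plaquetteAction` — ds-4's robust star window (`PlaquetteActionWindow.plaquetteAction_abs_covariance_le`,
  Lemma G at the effective coefficient `c_eff`) in rb-theory's clustering currency: `ClustersWith W β A m` with
  `m = (1 − ρ)²/(2(2ρ·2d + 1))`, `ρ = R_G^{(d)}(c_eff)`, `A = 4(2√N)² e^{2m}` (base-point distance `n` ⇒ endpoint
  distance `≥ n − 2`), for every torus side `L ≥ 3` — constants depending on `(d, N, c_eff)` only.
-/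

noncomputable section

open MeasureTheory ProbabilityTheory Function Finset Real
open Literature.Probability.LatticeModels
open Literature.Probability.LatticeModels.DobrushinMetric
open Literature.MathematicalPhysics.QuantumLattice (groupHeatKernelMeasure groupHeatKernelMeasure_eq
  groupHeatKernelWeight fundamentalRep fundamentalRep_apply)
open Literature.MathematicalPhysics.QuantumFieldTheory
open Literature.MathematicalPhysics.QuantumFieldTheory.Balaban1983to89.StrongCouplingDobrushinWindow (OneLinkKRModulus)
open Literature.MathematicalPhysics.QuantumFieldTheory.Balaban1983to89.StrongCouplingTorusWindow
open Summit.Ventures.YMGap.DSWindow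
open Summit.Ventures.YMGap.StarResolventDim (gaugeR doorPoly Delta_pos_of_door gaugeR_lt_one_of_door)
open Summit.Ventures.YMGap.PlaquetteActionWindow

namespace Summit.Ventures.YMGap.RobustBall

variable {d L N : ℕ} [NeZero L]

/-! ### The specification bridge -/

/-- **A plaquette-action member IS a plaquette-weight specification**: if `W.total U = Σ_q f(U_q)` then
`perturbedTorusSpec W β = torusWeightSpec (v_β · e^{−f})` (both are product Haar glued and tilted; the energies agree:
`Σ_q log(v_β(U_q) e^{−f(U_q)}) = Σ_q log v_β(U_q) − W.total U`). [folklore] -/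
theorem perturbedTorusSpec_eq_torusWeightSpec {f : SUN N → ℝ} {W : Perturbation d L N} (hW : IsPlaquetteAction f W)
    (β : ℝ) : perturbedTorusSpec W β = torusWeightSpec fun g => wilsonPlaqWeight N β g * Real.exp (-f g) := by
  funext Λ η
  simp only [perturbedTorusSpec, torusWeightSpec]
  congr 1
  funext U
  rw [hW U, torusLogWeight, torusLogWeight, ← Finset.sum_sub_distrib]
  refine Finset.sum_congr rfl fun q _ => ?_
  rw [Real.log_mul (wilsonPlaqWeight_pos (N := N) β _).ne' (exp_pos _).ne', Real.log_exp]
  ring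

/-! ### The measure bridge -/

/-- **The member's torus measure is the plaquette-weight measure of `v_β e^{−f}`**:
`W.perturbedMeasure (fundamentalRep (Fin N)) β = groupHeatKernelMeasure (fun _ => v_β e^{−f}) 0` when
`W.total = Σ_q f(U_q)` (same computation as `wilsonMeasure_eq_groupHeatKernelMeasure`:
`∏_q v_β(U_q) e^{−f(U_q)} = exp(−β S_W(U) − W.total U)`). [folklore] -/
theorem perturbedMeasure_eq_groupHeatKernelMeasure {f : SUN N → ℝ} {W : Perturbation d L N}
    (hW : IsPlaquetteAction f W) (β : ℝ) :
    W.perturbedMeasure (fundamentalRep (Fin N)) β =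
      groupHeatKernelMeasure (d := d) (L := L) (fun _ : ℝ => fun g : SUN N => wilsonPlaqWeight N β g * Real.exp (-f g)) 0 := by
  have hw : ∀ U : GaugeConfig d L (SUN N),
      groupHeatKernelWeight (d := d) (L := L) (fun _ : ℝ => fun g : SUN N => wilsonPlaqWeight N β g * Real.exp (-f g)) 0 U =
        Real.exp (-β * wilsonAction (fundamentalRep (Fin N)) U - W.total U) := by
    intro U
    rw [hW U]
    simp only [groupHeatKernelWeight, wilsonPlaqWeight, wilsonAction, fundamentalRep_apply, neg_mul,
      Finset.mul_sum, ← Real.exp_add, sub_eq_add_neg]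
    rw [← Finset.sum_neg_distrib, ← Finset.sum_add_distrib, Real.exp_sum]
  unfold QuasiLocalGaugePerturbation.perturbedMeasure QuasiLocalGaugePerturbation.partitionFunction
    QuasiLocalGaugePerturbation.weight
  rw [groupHeatKernelMeasure_eq]
  simp only [hw]

/-! ### The plaquette rung in the clustering currency `ClustersWith` -/

omit [NeZero L] in
/-- An endpoint of a link is within periodic sup-distance `1` of its base point. [folklore] -/
theorem torusNorm_linkEnds_sub_fst_le_one {x : Edge d L} {a : Site d L} (ha : a ∈ linkEnds x) :
    torusNorm (a - x.1) ≤ 1 := by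
  refine torusNorm_sub_le_one_of_offsets (c := x.1) (fun k => ?_) (fun k => Or.inl (sub_self _))
  rcases mem_linkEnds.1 ha with rfl | rfl
  · exact Or.inl (sub_self _)
  · by_cases hk : k = x.2
    · subst hk
      right
      simp [Literature.MathematicalPhysics.QuantumFieldTheory.Site.shift]
    · left
      simp [Literature.MathematicalPhysics.QuantumFieldTheory.Site.shift, hk]

omit [NeZero L] in
/-- Base points at sup-distance `≥ n` have endpoints at sup-distance `≥ n − 2`. [folklore] -/
theorem le_torusNorm_linkEnds_sub {x z : Edge d L} {n : ℕ} (h : n ≤ torusNorm (x.1 - z.1)) {a w : Site d L}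
    (ha : a ∈ linkEnds x) (hw : w ∈ linkEnds z) : n - 2 ≤ torusNorm (a - w) := by
  have h1 : torusNorm (x.1 - a) ≤ 1 := by
    rw [← torusNorm_neg, neg_sub]; exact torusNorm_linkEnds_sub_fst_le_one ha
  have h2 : torusNorm (w - z.1) ≤ 1 := torusNorm_linkEnds_sub_fst_le_one hw
  have h3 := torusNorm_sub_le x.1 a z.1
  have h4 := torusNorm_sub_le a w z.1
  omega

/-- **THE PLAQUETTE RUNG: torus clustering of a plaquette-action member in the currency `ClustersWith`.**  Let
`N ≥ 1`, `d ≥ 2`, `L ≥ 3`; `OneLinkKRModulus N R K` (`K ≥ 0`) on `R ≥ 2(d−1)|β|/N`; `f` a continuous inversion-invariant class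
function with `f x − f y ≤ a₀`, `|f x − f y| ≤ λ‖x − y‖_F` (`λ ≥ 0`); `W` a member with `W.total = Σ_q f(U_q)`; and
`doorPoly d c_eff < 1` at `c_eff = K e^{2(d−1)a₀}(1 + 2√N·2(d−1)λ)|β|/N + √N λ`.  Then `ClustersWith W β A m` with
`m = (1 − ρ)²/(2(2ρ·2d + 1))`, `ρ = R_G^{(d)}(c_eff)`, `A = 4(2√N)² e^{2m}` — the member's torus measure clusters
exponentially for bounded measurable local link-Lipschitz observables, rate and amplitude depending on `(d, N, c_eff)`
only (`PlaquetteActionWindow.plaquetteAction_abs_covariance_le` through the measure bridge; base-point distance `n`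
gives endpoint distance `≥ n − 2`, whence the factor `e^{2m}`). [folklore] -/
theorem clustersWith_plaquetteAction (hd : 2 ≤ d) (hN : 1 ≤ N) (hL : 3 ≤ L) {β R K a₀ lam : ℝ}
    (hK : 0 ≤ K) (hlam : 0 ≤ lam) (hR : |β| / N * (2 * ((d : ℝ) - 1)) ≤ R) (hmod : OneLinkKRModulus N R K)
    {f : SUN N → ℝ} (hfc : Continuous f) (hfconj : ∀ g h : SUN N, f (g * h * g⁻¹) = f h)
    (hfinv : ∀ h : SUN N, f h⁻¹ = f h) (hfosc : ∀ x y, f x - f y ≤ a₀)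
    (hflip : ∀ x y, |f x - f y| ≤ lam * suFrobDist x y)
    {W : Perturbation d L N} (hW : IsPlaquetteAction f W)
    {c : ℝ} (hc : c = K * Real.exp (2 * ((d : ℝ) - 1) * a₀) * (1 + 2 * Real.sqrt N * (2 * ((d : ℝ) - 1) * lam)) *
      (|β| / N) + Real.sqrt N * lam) (hcd : doorPoly d c < 1) :
    ClustersWith W β
      (4 * (2 * Real.sqrt N) ^ 2 *
        Real.exp (2 * ((1 - gaugeR d c) ^ 2 / (2 * (2 * gaugeR d c * (2 * d : ℕ) + 1)))))
      ((1 - gaugeR d c) ^ 2 / (2 * (2 * gaugeR d c * (2 * d : ℕ) + 1))) := by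
  intro F G ΔF ΔG δF δG n hFm hGm hFdep hGdep hFb hGb hFlip hGlip hdist
  set m : ℝ := (1 - gaugeR d c) ^ 2 / (2 * (2 * gaugeR d c * (2 * d : ℕ) + 1)) with hm
  rw [perturbedMeasure_eq_groupHeatKernelMeasure hW β]
  have hFobs : LinkObs suFrobDist F ΔF δF := ⟨hFm, hFb, hFdep, hFlip.nonneg, hFlip.le⟩
  have hGobs : LinkObs suFrobDist G ΔG δG := ⟨hGm, hGb, hGdep, hGlip.nonneg, hGlip.le⟩
  have hL₀ : ∀ x ∈ ΔF, ∀ z ∈ ΔG, ∀ a ∈ linkEnds x, ∀ w ∈ linkEnds z, n - 2 ≤ torusNorm (a - w) :=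
    fun x hx z hz a ha w hw => le_torusNorm_linkEnds_sub (hdist x hx z hz) ha hw
  have key := plaquetteAction_abs_covariance_le (d := d) (L := L) hd hN hL hK hlam hR hmod hfc hfconj hfinv hfosc hflip
    (v := fun g : SUN N => wilsonPlaqWeight N β g * Real.exp (-f g)) (fun _ => rfl) hc hcd hFobs hGobs (n - 2) hL₀
  refine key.trans ?_
  have ha0 : 0 ≤ a₀ := by simpa using hfosc 1 1
  have hd0 : (0 : ℝ) ≤ (d : ℝ) - 1 := by
    have : (2 : ℝ) ≤ d := by exact_mod_cast hd
    linarith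
  have hc0 : 0 ≤ c := by rw [hc]; positivity
  have hρ : 0 ≤ gaugeR d c ∧ gaugeR d c < 1 := gaugeR_lt_one_of_door hd hc0 hcd
  have hm0 : 0 ≤ m := by rw [hm]; have := hρ.1; positivity
  have hδF : 0 ≤ ∑ x ∈ ΔF, δF x := Finset.sum_nonneg fun x _ => hFlip.nonneg x
  have hδG : 0 ≤ ∑ y ∈ ΔG, δG y := Finset.sum_nonneg fun y _ => hGlip.nonneg y
  have hexp : Real.exp (-(m * ((n - 2 : ℕ) : ℝ))) ≤ Real.exp (2 * m) * Real.exp (-m * n) := by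
    rw [← Real.exp_add]
    refine Real.exp_le_exp.2 ?_
    have hcast : (n : ℝ) - 2 ≤ ((n - 2 : ℕ) : ℝ) := by
      rcases Nat.lt_or_ge n 2 with h | h
      · have : ((n - 2 : ℕ) : ℝ) = 0 := by rw [Nat.sub_eq_zero_of_le h.le]; simp
        rw [this]
        have : (n : ℝ) < 2 := by exact_mod_cast h
        linarith
      · rw [Nat.cast_sub h]; push_cast; exact le_rfl
    nlinarith
  calc 4 * (2 * Real.sqrt N) ^ 2 * Real.exp (-(m * ((n - 2 : ℕ) : ℝ))) * (∑ x ∈ ΔF, δF x) * ∑ y ∈ ΔG, δG y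
      ≤ 4 * (2 * Real.sqrt N) ^ 2 * (Real.exp (2 * m) * Real.exp (-m * n)) * (∑ x ∈ ΔF, δF x) * ∑ y ∈ ΔG, δG y := by
        gcongr
    _ = 4 * (2 * Real.sqrt N) ^ 2 * Real.exp (2 * m) * (∑ y ∈ ΔG, δG y) * (∑ x ∈ ΔF, δF x) * Real.exp (-m * n) := by
        ring

end Summit.Ventures.YMGap.RobustBall

namespace Summit.Ventures.YMGap.RobustBall

/-! ### rb-theory's typed target, discharged (appended once `RobustBall/Targets` was in the tree) -/

/-- **`PlaquetteBridgeTarget N d` holds**: a plaquette-action member IS a plaquette-weight specification —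
`perturbedTorusSpec_eq_torusWeightSpec` in the binder shape of `RobustBall.Targets`. [folklore] -/
theorem plaquetteBridgeTarget_holds {N d : ℕ} : PlaquetteBridgeTarget N d :=
  fun _ _ _ _ β hW => perturbedTorusSpec_eq_torusWeightSpec hW β

end Summit.Ventures.YMGap.RobustBall
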